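import Summits.AnomalousDissipation.AnomalousDissipation.Theorems.LimitingAbsorptionKinematicSteadySourceLawToolkit
import Literature.Analysis.FluidPDE.PassiveScalarForcedClass
import HarnessLib

/-!
# Route LimitingAbsorption — `RelaxationBoundsInventory`: forced uniqueness transfers a slice bound

Stub `stub_sliceBoundTransfer` (S4) of line `Sketch` for crux stmt-AnomalousDissipation-2940
(`Summit.AnomalousDissipation.AnomalousDissipation.Theses.LimitingAbsorption.RelaxationBoundsInventory`).

For `κ > 0` and a drift `u ∈ L^∞((0,T) × T^d)`, two sourced weak passive scalars
(`Torus.IsWeakScalarTransportForcedOn`) with the same source `s` and datum `θ₀` agree at a.e.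
time `t ∈ (0,T)` — forced uniqueness for bounded drift,
`KinematicSteadySourceLaw.forced_ae_eq_of_memLp_top`. Hence a slice bound
`∫⁻ ‖W t‖ₑ² ≤ B` (a.e. `t`) of one of them, `W`, is the bound `scalarL2Sq (θ t) ≤ B` (a.e. `t`)
of the other, `θ`, in the `scalarL2Sq` currency of the route file: at a.e. `t` one has
`θ t =ᵐ W t`, so the two `lintegral`s agree (`lintegral_congr_ae`), and `θ t ∈ L²`
(`IsWeakScalarTransportForcedOn.ae_memLp_two`) makes `scalarL2Sq (θ t)` the real part of the
finite `lintegral` (`KinematicSteadySourceLaw.scalarL2Sq_eq_toReal_lintegral_and_lt_top`).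

In the crux, `θ` is THE given sourced weak scalar (steady source `h`, zero datum) and `W` is the
weak-* limit of the Riemann–Duhamel superpositions.

## References

* T. Drivas, T. Elgindi, G. Iyer, I.-J. Jeong, ARMA 243 (2022), (1.3). [`DEIJ2022`]
* R. J. DiPerna, P.-L. Lions, Invent. Math. 98 (1989), §II.1–II.3. [`DiPernaLions1989`]
-/

noncomputable section

open MeasureTheory Set Filter Function TopologicalSpace Topology
open scoped ENNReal NNReal InnerProductSpace BigOperators

namespace Summit.AnomalousDissipation.AnomalousDissipation.Theorems.RelaxationBoundsInventory.SliceBoundTransfer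

set_option linter.dupNamespace false

open Literature.Analysis Literature.Analysis.FluidPDE Literature.Analysis.FluidPDE.Torus

variable {d : Type*} [Fintype d]

/-- **S4 `stub_sliceBoundTransfer`.** For `κ > 0` and a drift `u ∈ L^∞((0,T) × T^d)`, two sourced
weak solutions with the same source and datum agree at a.e. time (landed
`KinematicSteadySourceLaw.forced_ae_eq_of_memLp_top`), so a slice bound `∫ |W(t)|² ≤ B` of one is
the bound `scalarL2Sq (θ t) ≤ B` of the other, for a.e. `t ∈ (0,T)` (`θ(t) ∈ L²` a.e.,
`IsWeakScalarTransportForcedOn.ae_memLp_two`). [folklore] -/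
theorem stub_sliceBoundTransfer {T κ : ℝ} (hκ : 0 < κ) {u : ℝ → UnitAddTorus d → EuclideanSpace ℝ d}
    (hu : MemLp (FunctionSpaces.Torus.stLift u) ⊤ (volume.restrict (Ioo 0 T ×ˢ univ)))
    {s : ℝ → UnitAddTorus d → ℝ} {θ₀ : UnitAddTorus d → ℝ} {θ W : ℝ → UnitAddTorus d → ℝ}
    (hθ : IsWeakScalarTransportForcedOn T κ u s θ₀ θ) (hW : IsWeakScalarTransportForcedOn T κ u s θ₀ W)
    {B : ℝ≥0} (hWb : ∀ᵐ t ∂(volume.restrict (Ioo 0 T)), ∫⁻ x, ‖W t x‖ₑ ^ 2 ≤ B) :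
    ∀ᵐ t ∂(volume.restrict (Ioo 0 T)), scalarL2Sq (θ t) ≤ (B : ℝ) := by
  have hae : ∀ᵐ t ∂(volume.restrict (Ioo 0 T)), θ t =ᵐ[volume] W t :=
    KinematicSteadySourceLaw.forced_ae_eq_of_memLp_top hκ hθ hW hu
  filter_upwards [hae, hWb, hθ.ae_memLp_two] with t h1 h2 h3
  have heq : ∫⁻ x, ‖θ t x‖ₑ ^ 2 = ∫⁻ x, ‖W t x‖ₑ ^ 2 := by
    refine lintegral_congr_ae ?_
    filter_upwards [h1] with x hx
    rw [hx]
  have hle : ∫⁻ x, ‖θ t x‖ₑ ^ 2 ≤ B := heq.le.trans h2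
  calc scalarL2Sq (θ t) = (∫⁻ x, ‖θ t x‖ₑ ^ 2).toReal :=
        (KinematicSteadySourceLaw.scalarL2Sq_eq_toReal_lintegral_and_lt_top h3).1
    _ ≤ ((B : ℝ≥0∞)).toReal := ENNReal.toReal_mono ENNReal.coe_ne_top hle
    _ = (B : ℝ) := ENNReal.coe_toReal B

end Summit.AnomalousDissipation.AnomalousDissipation.Theorems.RelaxationBoundsInventory.SliceBoundTransfer

end
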